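import Summits.BirchSwinnertonDyer.Rank1Residual.Additive.X4RankZeroVisibleLowerBoundPrimeList
import Summits.BirchSwinnertonDyer.Rank1Residual.Additive.X4RankZeroCoveredLocusNoLemma20
import HarnessLib

/-!
# X4(M) ∧ `r = 0` at `p = 3`: the VISIBILITY ENDs with the (M)-branch fact list ONLY — the idle
# potentially-good Kato reading `hKatoS` OUT, nothing added
# (cell `b2b-bsdres`, team n1011, ROW T-DEL98X addendum, seat p10 GEN 10, FILE 5)

HONEST FRAMING (cell `b2b-bsdres`, run/shared/lean/b2b/bsd-rank1-residual/, verbatim in every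
file): the goal of the cell is to DELETE the COMBINATION-SHAPED residual classes of the
Birch–Swinnerton-Dyer formula for ALL analytic-rank `≤ 1` elliptic curves over `ℚ` — "full BSD
formula for every rank `≤ 1` curve in class `C`" assembled STRICTLY from published theorems — so
that the rank-`≤ 1` remainder becomes exactly the CONSTRUCTION-SHAPED classes, which are TYPED
(missing-input `Prop`s), NOT attempted. This is not "finishing BSD". Team n1011 (N10 / N11): research
route; END-twin theorems only — no definition, no named fact, no `sorry`; PER-PAIR certificate SHAPES,
not a class theorem; nothing booked; no residual-map mark / label / count moved; the ENDs CLOSE NOTHING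
by themselves (θ, `hrank`, `hloc` are per-row inputs). NOTHING of p03's / additive-p1's / additive-p4's /
x11c's is edited: the declarations below are NEW and consume theirs BY NAME.

## What and why

p03's visibility ENDs for the potentially MULTIPLICATIVE rows at `3`
(`X4RankZero.bsdp_three_potMult_of_congr_of_rank_two[_of_primeList]`,
`Additive/X4RankZeroVisibleLowerBound[PrimeList].lean`) obtain their UPPER half from additive-p4's
KIND-AGNOSTIC covered-locus chain `X4RankZero.bsdp_of_facts_of_lower[_noL20]`, which case-splits on
`ord₃ j(E) < 0` INSIDE the proof and therefore DISPLAYS the facts of BOTH branches: on an (M) row the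
potentially-GOOD sharp Kato reading `hKatoS : Kato2004.rankZero_padicValNat_sha_le_sub_localTamagawa_of_additive_potGood_of_imageContainsSL2`
(A161) is displayed but never used (the (M) branch is
`AdditivePotMult.ClassX4M.missingUpperBoundAt_rankZero_of_surj[_noL20]`: Delbourgo 1998 Prop. 4 `hDel`,
`hmodD`, Kato's half-eigen divisibility `hKatoχ`, GZK, modularity). This file states the same ENDs over
the (M)-SPECIFIC upper half (n1011-p14's `hL20`-free `ClassX4M.bsdp_rankZero_of_surj_of_lower_noL20`),
so the displayed named facts are EXACTLY the (M) branch's: {hDel, hGZK, hmod, hmodD, hKatoχ, hCT} —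
binder diff against p03's ENDs EXACTLY {`hKatoS`} ↦ ∅, NOTHING added, conclusions and every typed
per-row binder identical (7 ↦ 6 named facts). Records over these ENDs (n1011-p18's `bsdp3_vis_v<E>` on
the (M) PASS-rank rows, n1011-p07's `…Hesse_v<E>` twins) may re-key by a one-token change; nothing of
theirs is touched here.

* `X4RankZero.bsdp_three_potMult_of_selmerGroup_ne_bot_potMultFacts` — the native `Sel⁽³⁾ ≠ 0` line;
* `X4RankZero.bsdp_three_potMult_of_congr_of_rank_two_potMultFacts` — the C-VIS certificate shape
  (finite place set `S`);
* `X4RankZero.bsdp_three_potMult_of_congr_of_rank_two_of_primeList_potMultFacts` — x11c's prime-list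
  pattern (`hloc` per rational prime of a list `L ∋ 3` supporting both discriminants).

Axioms standard. References: [CremonaMazur2000] §3, Table 1; [AgasheStein2002] Thm. 3.1;
[Delbourgo1998] Prop. 4 (p. 144); [Kato2004Asterisque] Thm. 17.4 (3) (p. 273); [Wuthrich2014] Cor. 19
(p. 398); [SilvermanAEC2009] X.4.2 (a), X.4.14, VII.5.1 (a); [Miller2011LMS] Def. 1.1.
-/

noncomputable section

open scoped Classical

open WeierstrassCurve Literature.NumberTheory.EllipticCurves
  Literature.NumberTheory.EllipticCurves.ModularForms
  Literature.NumberTheory.EllipticCurves.Rank1Residual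
  Literature.NumberTheory.EllipticCurves.Rank1Residual.Typed
  NumberField IsDedekindDomain Rat.HeightOneSpectrum

namespace Summit.BirchSwinnertonDyer.Rank1Residual.Additive

/-- **X4 ∧ `r_an = 0`, potentially MULTIPLICATIVE at `3`, `ρ̄_{E,3}` onto, `ord₃ #Ш_an ≤ 2`,
`Sel⁽³⁾(E/ℚ) ≠ 0`: `BSD(E,3)`** from the (M)-branch facts ONLY — additive-p4's
`X4RankZero.bsdp_three_potMult_of_selmerGroup_ne_bot[_noL20]` with `{hKatoS}` ↦ ∅: the lower half is
`Supersingular.missingLowerBoundAt_of_casselsTate_of_selmerGroup_ne_bot` (class-free: rank `0` by GZK,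
`3 ∤ #E(ℚ)_tors` by irreducibility, Cassels–Tate), the upper half n1011-p14's
`ClassX4M.bsdp_rankZero_of_surj_of_lower_noL20`. [cite: Delbourgo1998, Prop. 4 (p. 144)]
[cite: Kato2004Asterisque, Thm. 17.4 (3) (p. 273)] [cite: SilvermanAEC2009, Thm. X.4.2 and Thm. X.4.14]
[cite: Miller2011LMS, §1 and Def. 1.1] -/
theorem X4RankZero.bsdp_three_potMult_of_selmerGroup_ne_bot_potMultFacts
    (W : WeierstrassCurve ℚ) [W.IsElliptic] [W.IsGloballyMinimal]
    (hDel : Delbourgo1998.prop4_rankZero_pow_dvd_constantCoeff)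
    (hGZK : rank_eq_analyticRank_of_analyticRank_le_one) (hmod : hasEntireLFunction_rat)
    (hmodD : nonempty_modularParametrizationData)
    (hKatoχ : Wuthrich2014.kato_halfEigenCharIdeal_dvd_cyclotomicPrime_of_surjective)
    (hCT : exists_casselsTate_pairing (K := ℚ)) (hr : W.analyticRank = 0)
    (hX : haveI : Fact (Nat.Prime 3) := ⟨Nat.prime_three⟩; ClassX4 W 3)
    (hsurj : W.HasSurjectiveModNGaloisRep 3) (hj : padicValRat 3 W.j < 0) {q : ℚ}
    (hq : shaAn W = (q : ℂ)) (hv : padicValRat 3 q ≤ 2) (hSel : W.selmerGroup ((3 : ℕ) : ℤ) ≠ ⊥) :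
    haveI : Fact (Nat.Prime 3) := ⟨Nat.prime_three⟩
    BSDp W 3 :=
  haveI : Fact (Nat.Prime 3) := ⟨Nat.prime_three⟩
  AdditivePotMult.ClassX4M.bsdp_rankZero_of_surj_of_lower_noL20 hDel hGZK hmod hmodD hKatoχ
    ⟨hX, hX.2.1, hj⟩ hr hsurj
    (Supersingular.missingLowerBoundAt_of_casselsTate_of_selmerGroup_ne_bot W 3 hCT hGZK hr
      (Supersingular.not_dvd_torsionOrder_of_irr W 3 hX.2.2) hq hv hSel)

/-- **X4 ∧ `r = 0`, potentially MULTIPLICATIVE at `3`, `ρ̄_{E,3}` onto, `ord₃ #Ш_an ≤ 2`: `BSD(E,3)`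
from a VISIBLE element of `Ш(E)[3]` supplied by a `3`-congruent curve of rank `≥ 2`**, (M)-branch facts
ONLY — p03's `X4RankZero.bsdp_three_potMult_of_congr_of_rank_two` with `{hKatoS}` ↦ ∅ (its proof token
for token, the last call re-pointed). Composition: `exists_sha_ne_zero_of_congr_of_rank` (Cremona–Mazur /
Agashe–Stein count, no condition at `3`) → `exists_selmerToSha_eq` → the theorem above.
[cite: CremonaMazur2000, §3 and Table 1] [cite: AgasheStein2002, Thm. 3.1]
[cite: Delbourgo1998, Prop. 4 (p. 144)] [cite: SilvermanAEC2009, Thm. X.4.2 (a) and X.4.14] -/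
theorem X4RankZero.bsdp_three_potMult_of_congr_of_rank_two_potMultFacts
    (hDel : Delbourgo1998.prop4_rankZero_pow_dvd_constantCoeff)
    (hGZK : rank_eq_analyticRank_of_analyticRank_le_one) (hmod : hasEntireLFunction_rat)
    (hmodD : nonempty_modularParametrizationData)
    (hKatoχ : Wuthrich2014.kato_halfEigenCharIdeal_dvd_cyclotomicPrime_of_surjective)
    (hCT : exists_casselsTate_pairing (K := ℚ))
    (W : WeierstrassCurve ℚ) [W.IsElliptic] [W.IsGloballyMinimal] (hr : W.analyticRank = 0)
    (hX : haveI : Fact (Nat.Prime 3) := ⟨Nat.prime_three⟩; ClassX4 W 3)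
    (hsurj : W.HasSurjectiveModNGaloisRep 3) (hj : padicValRat 3 W.j < 0)
    {q : ℚ} (hq : shaAn W = (q : ℂ)) (hv : padicValRat 3 q ≤ 2)
    (W' : WeierstrassCurve ℚ) [W'.IsElliptic]
    (θ : geomTorsion W' ((3 : ℕ) : ℤ) ≃+ geomTorsion W ((3 : ℕ) : ℤ))
    (hθ : ∀ (σ : Field.absoluteGaloisGroup ℚ) (P : geomTorsion W' ((3 : ℕ) : ℤ)),
      θ (σ • P) = σ • θ P)
    (hrank : 2 ≤ W'.mordellWeilRank) (S : Finset (HeightOneSpectrum (𝓞 ℚ)))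
    (hS : ∀ v : HeightOneSpectrum (𝓞 ℚ), v ∉ S →
      W.HasGoodReductionAt v ∧ W'.HasGoodReductionAt v ∧ ((3 : ℕ) : 𝓞 ℚ) ∉ v.asIdeal)
    (hloc : ∀ v ∈ S, Nat.card (nsmulAddMonoidHom 3 :
      (W'.baseChange (v.adicCompletion ℚ)).toAffine.Point →+ _).ker = 1) :
    haveI : Fact (Nat.Prime 3) := ⟨Nat.prime_three⟩
    BSDp W 3 := by
  haveI : Fact (Nat.Prime 3) := ⟨Nat.prime_three⟩
  haveI : Finite W.toAffine.Point := finite_point_of_analyticRank_eq_zero W hGZK hr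
  have hirr : Irr W 3 := hasIrreducibleModPGaloisRep_of_hasSurjectiveModNGaloisRep W 3 hsurj
  have hrank' : Module.finrank ℚ ℚ + 1 ≤ W'.mordellWeilRank := by rwa [Module.finrank_self]
  obtain ⟨c, hc0, hc3⟩ := W.exists_sha_ne_zero_of_congr_of_rank W' (by norm_num) θ hθ S hS ‹_›
    (coprime_natCard_point_of_irr W 3 hirr) hrank' hloc
  obtain ⟨z, hz⟩ := exists_selmerToSha_eq W (n := ((3 : ℕ) : ℤ)) (by norm_num) c (by exact_mod_cast hc3)
  have hSel : W.selmerGroup ((3 : ℕ) : ℤ) ≠ ⊥ := by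
    intro hbot
    have hmem : (z : W.galH1Torsion ((3 : ℕ) : ℤ)) ∈ (⊥ : AddSubgroup _) := hbot ▸ z.2
    have hz0 : z = 0 := Subtype.ext ((AddSubgroup.mem_bot).mp hmem)
    exact hc0 (by rw [← hz, hz0, map_zero])
  exact X4RankZero.bsdp_three_potMult_of_selmerGroup_ne_bot_potMultFacts W hDel hGZK hmod hmodD hKatoχ
    hCT hr hX hsurj hj hq hv hSel

/-- **p03's (M)-END with `S` = the places over a list of rational primes `L ∋ 3`** supporting both
discriminants (`E₀`, `F₀` integer models of `W`, `W′`), (M)-branch facts ONLY — x11c's prime-list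
pattern, `X4RankZero.bsdp_three_potMult_of_congr_of_rank_two_of_primeList` with `{hKatoS}` ↦ ∅ (proof
token for token, the inner END re-pointed). [cite: SilvermanAEC2009, VII.5 Prop. 5.1(a)]
[cite: CremonaMazur2000, §3 and Table 1] [cite: Delbourgo1998, Prop. 4 (p. 144)] -/
theorem X4RankZero.bsdp_three_potMult_of_congr_of_rank_two_of_primeList_potMultFacts
    (hDel : Delbourgo1998.prop4_rankZero_pow_dvd_constantCoeff)
    (hGZK : rank_eq_analyticRank_of_analyticRank_le_one) (hmod : hasEntireLFunction_rat)
    (hmodD : nonempty_modularParametrizationData)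
    (hKatoχ : Wuthrich2014.kato_halfEigenCharIdeal_dvd_cyclotomicPrime_of_surjective)
    (hCT : exists_casselsTate_pairing (K := ℚ))
    (W : WeierstrassCurve ℚ) [W.IsElliptic] [W.IsGloballyMinimal] (hr : W.analyticRank = 0)
    (hX : haveI : Fact (Nat.Prime 3) := ⟨Nat.prime_three⟩; ClassX4 W 3)
    (hsurj : W.HasSurjectiveModNGaloisRep 3) (hj : padicValRat 3 W.j < 0)
    {q : ℚ} (hq : shaAn W = (q : ℂ)) (hv : padicValRat 3 q ≤ 2)
    (W' : WeierstrassCurve ℚ) [W'.IsElliptic]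
    (θ : geomTorsion W' ((3 : ℕ) : ℤ) ≃+ geomTorsion W ((3 : ℕ) : ℤ))
    (hθ : ∀ (σ : Field.absoluteGaloisGroup ℚ) (P : geomTorsion W' ((3 : ℕ) : ℤ)),
      θ (σ • P) = σ • θ P)
    (hrank : 2 ≤ W'.mordellWeilRank)
    {E₀ F₀ : WeierstrassCurve ℤ} (hE : E₀.map (Int.castRingHom ℚ) = W)
    (hF : F₀.map (Int.castRingHom ℚ) = W') (L : List ℕ) (h3L : 3 ∈ L)
    (hΔE : ∀ q : ℕ, q.Prime → (q : ℤ) ∣ E₀.Δ → q ∈ L)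
    (hΔF : ∀ q : ℕ, q.Prime → (q : ℤ) ∣ F₀.Δ → q ∈ L)
    (hloc : ∀ v : HeightOneSpectrum (𝓞 ℚ), (primesEquiv v : ℕ) ∈ L →
      Nat.card (nsmulAddMonoidHom 3 :
        (W'.baseChange (v.adicCompletion ℚ)).toAffine.Point →+ _).ker = 1) :
    haveI : Fact (Nat.Prime 3) := ⟨Nat.prime_three⟩
    BSDp W 3 := by
  set e := primesEquiv (R := 𝓞 ℚ) with he
  -- the finite set of places over `L`
  set S : Finset (HeightOneSpectrum (𝓞 ℚ)) :=
    (L.filterMap fun q ↦ if h : q.Prime then some (e.symm ⟨q, h⟩) else none).toFinset with hSdef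
  have hmemS : ∀ v : HeightOneSpectrum (𝓞 ℚ), v ∈ S ↔ (e v : ℕ) ∈ L := by
    intro v
    rw [hSdef, List.mem_toFinset, List.mem_filterMap]
    constructor
    · rintro ⟨q, hq, hqv⟩
      by_cases hqp : q.Prime
      · rw [dif_pos hqp, Option.some.injEq] at hqv
        rw [← hqv, Equiv.apply_symm_apply]
        exact hq
      · rw [dif_neg hqp] at hqv
        exact absurd hqv (by simp)
    · intro hv
      refine ⟨(e v : ℕ), hv, ?_⟩
      rw [dif_pos (e v).2]
      simp
  refine X4RankZero.bsdp_three_potMult_of_congr_of_rank_two_potMultFacts hDel hGZK hmod hmodD hKatoχ hCT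
    W hr hX hsurj hj hq hv W' θ hθ hrank S (fun v hvS ↦ ?_) (fun v hvS ↦ hloc v ((hmemS v).mp hvS))
  have hvL : (e v : ℕ) ∉ L := fun h ↦ hvS ((hmemS v).mpr h)
  have hqp : (e v : ℕ).Prime := (e v).2
  refine ⟨?_, ?_, fun h3v ↦ hvL ?_⟩
  · rw [← hE]
    exact hasGoodReductionAt_map_of_not_dvd E₀ v fun h ↦ hvL (hΔE _ hqp h)
  · rw [← hF]
    exact hasGoodReductionAt_map_of_not_dvd F₀ v fun h ↦ hvL (hΔF _ hqp h)
  · rw [he, Rat.HeightOneSpectrum.primesEquiv_eq_of_natCast_mem v Nat.prime_three h3v]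
    exact h3L

end Summit.BirchSwinnertonDyer.Rank1Residual.Additive

end
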